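import Literature.AlgebraicGeometry.Resolution.Kuhlmann2019HenselianRationality
import Literature.AlgebraicGeometry.Resolution.GeneralizedStabilityHenselizedRational
import HarnessLib

/-!
# Henselian rationality in arbitrary rank: the ingredients of Kuhlmann 2019, Prop. 5.7

Topic: `Literature/AlgebraicGeometry/Resolution` (valued function fields). First layer of the
decomposition of the named fact `Kuhlmann2019_Thm13_sepClosed`
(`Kuhlmann2019HenselianRationality.lean`) = F.-V. Kuhlmann, *Elimination of ramification II:
Henselian rationality*, Israel J. Math. 234 (2019) = arXiv:1701.05508, **Thm. 1.3** for a
separably closed ground field `K` of ARBITRARY rank: an immediate separable function field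
`(F|K, v)` of transcendence degree `1` lies in `K(x)^h` for some `x ∈ F`. In the source, Thm. 1.3
(transcendence degree `1`) is **Prop. 5.7** (p. 14 of the arXiv version):

> Every immediate separable function field `(F|K,v)` of transcendence degree 1 over a separably
> tame field `(K,v)` of arbitrary rank is henselian rational.
> *Proof.* According to [17, Corollaries 3.8 and 3.16] there exists a separably tame subfield
> `K₀` of `K` of finite rank and a function field `F₀` of transcendence degree 1 over `K₀` with
> `K₀v = Kv` and `vK/vK₀` torsion free, such that `F = F₀.K` and that `vK₀` is cofinal in `vF₀`;
> since `F|K` is assumed to be separable, we may also assume `F₀|K₀` to be separable. If we are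
> able to show that (5.3) `F₀^h = K₀(x)^h` for some `x ∈ F₀ ⊆ F`, then it will follow that
> `F^h = (F₀.K)^h = (F₀^h.K)^h = (K₀(x)^h.K)^h = (K₀(x).K)^h = K(x)^h`, and our proposition will
> be proved. If `(F₀|K₀,v)` is immediate, then the existence of `x ∈ F₀` satisfying (5.3)
> follows from Proposition 5.6. Let us assume now that `(F₀|K₀,v)` is not immediate. We have:
> `K₀v ⊆ F₀v ⊆ Fv = Kv = K₀v`, so equality holds everywhere. … Since `vK/vK₀` is torsion free
> and `vF₀ ⊆ vF = vK`, also `vF₀/vK₀` is torsion free. Therefore, `trdeg F₀|K₀ = 1` is equal to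
> the rational rank of `vF₀/vK₀` and we can employ [17, Corollary 2.3] to obtain that the torsion
> free group `vF₀/vK₀` is finitely generated. It follows that `vF₀ = vK₀ ⊕ ℤvx = vK₀(x)` for a
> suitable `x ∈ F₀`. By Lemma 5.4 applied with `v_Q = v`, we may choose `x` to be a separating
> element of `F₀|K₀`. As `K₀v ⊆ K₀(x)v ⊆ F₀v ⊆ K₀v`, equality holds everywhere. Therefore,
> `(F₀|K₀(x),v)` is a finite immediate and separable extension. By Lemma 2.1, the same holds for
> `F₀^h|K₀(x)^h`. According to [16, Theorem 1], `(K₀(x),v)` is a separably defectless field,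
> and the same is true for `(K₀(x)^h,v)` by [4, Theorem (18.2)]. Hence the extension
> `F₀^h|K₀(x)^h` must be trivial, so (5.3) holds.

Here [17] = F.-V. Kuhlmann, *The algebra and model theory of tame valued fields*, J. reine
angew. Math. 719 (2016) = arXiv:1304.0194; [16] = *Elimination of ramification I* (Kuhlmann
2010); [4] = O. Endler, *Valuation theory* (1972), whose Thm. (18.2) is quoted in Kuhlmann 2010
as Thm. 2.14 ("The same holds for 'separably defectless' … For 'separably defectless', our
assertion follows directly from [En], Theorem (18.2)").

This file vendors the PRINTED INGREDIENTS of this proof as named facts, each specialised — never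
strengthened — to the case the head fact needs (`K` separably closed; everything inside one
algebraically closed valued field `(Ω, V)` as in `Kuhlmann2019HenselianRationality.lean`); the
assembly of `Kuhlmann2019_Thm13_sepClosed` from them is `Kuhlmann2019HenselianRationalityProofs.lean`
(`Kuhlmann2019_Thm13_sepClosed.of_prop56`). Two of the five facts are DISCHARGED in sibling files:
`Kuhlmann2019_Lemma54_holds` (`Kuhlmann2019Lemma54Proofs.lean`) and
`Kuhlmann2010SeparablyDefectlessIffHenselization_holds` (`HenselizationSeparablyDefectless.lean`).
For `K` separably closed the two conclusions of
[17, Cor. 3.8] that rest on the tameness of `K` (Lemma 3.7 / 3.15 there: "`K₀v = Kv` and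
`vK/vK₀` torsion free") follow from the others: the relative algebraic closure `K₀` of a subfield
in the separably closed `K` is separably closed, so `vK₀` is divisible and `K₀v` is algebraically
closed (Knaf–Kuhlmann 2009, Lemma 2.1, `KnafKuhlmann2009_Lemma21_holds`), whence `K₀v = Kv`
(as `Kv|K₀v` is algebraic) and `vK/vK₀` is torsion free. This is why `Kuhlmann2016_Cor38` below
records the CONSTRUCTION of the proof of Cor. 3.8 (valid over any valued base field) and not its
tame conclusions.

## Content

* `IsSeparablyDefectlessField K O` — "`(K,v)` is called a separably defectless field if it is
  defectless in every finite separable extension" (Kuhlmann 2010, §1, p. 3), typed, next to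
  `IsDefectlessField` (`ValuationDefect.lean`). DEFINITION;
  `IsDefectlessField.isSeparablyDefectlessField`. PROVED.
* `HasFiniteRank V M` — "`(M, v)` has finite rank, that is, its value group has only finitely
  many convex subgroups" ([17], before Cor. 3.8), rendered as in `FiniteRankOverPrimeField.lean` /
  `GeneralizedStabilityFiniteRank.lean`: the valuation ring `V ∩ M` of `M` has finitely many
  overrings. DEFINITION.
* `IsValueCofinal V K F` — "`vK` is cofinal in `vF`" (Kuhlmann 2010, Thm. 1.1; [17], Cor. 3.16).
  DEFINITION; `IsValueCofinal.of_isImmediateOver`. PROVED.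
* NAMED FACTS: `Kuhlmann2016_Cor38` ([17], Cor. 3.8 with Cor. 3.16: fields of definition of
  finite rank — the construction), `Kuhlmann2019_Prop56_sepClosed` (Prop. 5.6: finite rank),
  `Kuhlmann2019_Lemma54` (Lemma 5.4: separating elements with prescribed value and residue),
  `Kuhlmann2010SeparablyDefectlessRational_sepClosed` ([16] = Kuhlmann 2010, Thm. 1.1, the
  "separably defectless" clause, for `K(x)` with a value-transcendental `x` over a separably
  closed `K`), `Kuhlmann2010SeparablyDefectlessIffHenselization` (Kuhlmann 2010, Thm. 2.14 =
  [4, (18.2)], the "separably defectless" clause).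

## Sources

* [K19] F.-V. Kuhlmann, *Elimination of ramification II: Henselian rationality*, Israel J. Math.
  234 (2019) 927–958 = arXiv:1701.05508: Thm. 1.3 (p. 2), Lemma 2.1, §5: Lemma 5.4, Prop. 5.6,
  Prop. 5.7 (pp. 12–14).
* [K16] F.-V. Kuhlmann, *The algebra and model theory of tame valued fields*, J. reine angew.
  Math. 719 (2016) 1–43 = arXiv:1304.0194: Lemma 2.2, Cor. 2.3, Lemma 3.7, Cor. 3.8, Lemma 3.15,
  Cor. 3.16.
* [K10] F.-V. Kuhlmann, *Elimination of ramification I: The generalized stability theorem*,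
  Trans. AMS 362 (2010) = arXiv:1003.5678: §1 (p. 3: separably defectless; Thm. 1.1), Thm. 2.14,
  §5 (p. 20 of the arXiv version: the proof of the separably defectless clause).

## Rendering notes

* As in `Kuhlmann2019HenselianRationality.lean`: subfields `K ≤ F ≤ Ω` of ONE valued field
  `(Ω, V)` (algebraically closed where henselizations occur), `K(x) = Subfield.closure (K ∪ {x})`,
  "valued function field of transcendence degree `1`" = `FGOver` + a transcendental `t ∈ F` with
  `F` algebraic over `K(t)`, "separable" = `SeparablyGeneratedOver`, "immediate" =
  `IsImmediateOver`, "`y` is a separating element of `F|K`" = every element of `F` is separable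
  over `K(y)`, "relatively algebraically closed in `K`" = every element of `K` algebraic over `K₀`
  lies in `K₀`.
* "`x` value-transcendental" (`IsValueTranscendentalOver`, `GeneralizedStabilityHenselizedRational.lean`)
  makes `(K(x)|K, v)` a valued function field without transcendence defect
  (`trdeg = 1 = rr vK(x)/vK`), the hypothesis of [K10] Thm. 1.1.
-/

noncomputable section

namespace Literature.AlgebraicGeometry.Resolution

universe u

open IsLocalRing

/-! ### Separably defectless fields, finite rank, cofinality -/

section Defs

/-- **Separably defectless valued field** (Kuhlmann 2010, §1, p. 3: "`(K,v)` is called a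
defectless (or stable) field if it is defectless in every finite extension `L` of `K`. Finally,
`(K,v)` is called a separably defectless field if it is defectless in every finite separable
extension"): `(K, O)` is defectless (`IsDefectlessIn`: `∑ eᵢ fᵢ = [L : K]` over all extensions of
`O` to `L`) in every finite separable extension `L` of `K`.
[cite: Kuhlmann2010, Section 1 (p. 3 of arXiv:1003.5678)] -/
def IsSeparablyDefectlessField (K : Type u) [Field K] (O : ValuationSubring K) : Prop :=
  ∀ (L : Type u) [Field L] [Algebra K L], FiniteDimensional K L → Algebra.IsSeparable K L →
    IsDefectlessIn K O L

/-- A defectless field is separably defectless. [folklore] -/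
theorem IsDefectlessField.isSeparablyDefectlessField {K : Type u} [Field K] {O : ValuationSubring K}
    (h : IsDefectlessField K O) : IsSeparablyDefectlessField K O :=
  fun L _ _ hfin _ => h L hfin

variable {Ω : Type u} [Field Ω] (V : ValuationSubring Ω)

/-- **`(M, V ∩ M)` has finite rank** (Kuhlmann 2016, before Cor. 3.8: "of finite rank, that is,
its value group has only finitely many convex subgroups"; Kuhlmann 2010, §2.1: "The rank of a
valued field `(K,v)` is the order type of the chain of non-trivial convex subgroups of its value
group `vK`"), rendered as in `FiniteRankOverPrimeField.lean`: the valuation ring `V ∩ M` of the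
subfield `M ≤ Ω` has finitely many overrings (overrings ↔ prime ideals ↔ convex subgroups,
Zariski–Samuel VI §10). [cite: Kuhlmann2016, Section 3.1 (before Cor. 3.8)] -/
def HasFiniteRank (M : Subfield Ω) : Prop :=
  Finite {S : ValuationSubring M // V.comap (algebraMap M Ω) ≤ S}

/-- **`vK` is cofinal in `vF`** (Kuhlmann 2010, Thm. 1.1: "If `vK` is cofinal in `vF` …";
Kuhlmann 2016, Cor. 3.16), for subfields `K, F` of `(Ω, V)`: every value of a non-zero element
of `F` is bounded by the value of a non-zero element of `K` — in Mathlib's multiplicative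
notation, below it (additively: for every `α ∈ vF` there is `β ∈ vK` with `β ≥ α`; since `vK`,
`vF` are groups this is the same as cofinality from the other side). [cite: Kuhlmann2010, Thm. 1.1] -/
def IsValueCofinal (K F : Subfield Ω) : Prop :=
  ∀ a ∈ F, a ≠ 0 → ∃ b ∈ K, b ≠ 0 ∧ V.valuation b ≤ V.valuation a

variable {V}

/-- `vK` is cofinal in `vF` when `vF ⊆ vK`, e.g. for an immediate `F|K`. [folklore] -/
theorem IsValueCofinal.of_isImmediateOver {K F : Subfield Ω} (h : IsImmediateOver V K F) :
    IsValueCofinal V K F := by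
  intro a haF ha0
  obtain ⟨b, hbK, hab⟩ := h.1 a haF ha0
  refine ⟨b, hbK, fun hb0 => ha0 ?_, le_of_eq hab.symm⟩
  rw [hb0, map_zero] at hab
  exact (map_eq_zero V.valuation).mp hab

/-- Cofinality is inherited by intermediate extensions `K ≤ K' `, `F' ≤ F`. [folklore] -/
theorem IsValueCofinal.mono {K K' F F' : Subfield Ω} (h : IsValueCofinal V K F) (hK : K ≤ K')
    (hF : F' ≤ F) : IsValueCofinal V K' F' := fun a haF ha0 =>
  let ⟨b, hbK, hb0, hle⟩ := h a (hF haF) ha0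
  ⟨b, hK hbK, hb0, hle⟩

end Defs

/-! ### The named facts -/

/-- NAMED FACT — **Kuhlmann 2016, Cor. 3.8 with Cor. 3.16: fields of definition of finite rank
(the construction).** Cor. 3.8: "For every valued function field `F` with given transcendence
basis `𝒯` over a tame field `K`, there exists a tame subfield `K₀` of `K` of finite rank with
`K₀v = Kv` and `vK/vK₀` torsion free, and a function field `F₀` with transcendence basis `𝒯` over
`K₀` such that (13) `F = K.F₀` and (14) `[F₀:K₀(𝒯)] = [F:K(𝒯)]`. *Proof.* Let
`F = K(𝒯)(a₁,…,aₙ)`. There exists a finitely generated subfield `K₁` of `K` such that `a₁,…,aₙ`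
are algebraic over `K₁(𝒯)` … This will still hold if we replace `K₁` by any extension field of
`K₁` within `K`. As a finitely generated field, `(K₁,v)` has finite rank. Now let `y_j`, `j ∈ J`,
be a system of elements in `K` such that the residues `y_j v` form a transcendence basis of `Kv`
over `K₁v`. According to Lemma 2.2, the field `K₁(y_j | j ∈ J)` has residue field `K₁v(y_jv)` and
the same value group as `K₁`, hence it is again a field of finite rank. Let `K₀` be the relative
algebraic closure of this field within `K`. Since by construction, `Kv|K₁v(y_jv)` and thus also
`Kv|K₀v` are algebraic, we can infer from the preceding lemma [Lemma 3.7: tameness] that `K₀` is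
a tame field with `K₀v = Kv` and `vK/vK₀` torsion free. As an algebraic extension of a field of
finite rank, it is itself of finite rank. Finally, the function field `F₀ = K₀(𝒯)(a₁,…,aₙ)` has
transcendence basis `𝒯` over `K₀` and satisfies equations (13) and (14)." Cor. 3.16: "Corollary
3.8 also holds for separably tame fields in place of tame fields. More precisely, if `F|K` is a
separable extension, then `F₀` and `K₀` can be chosen such that `F₀|K₀` is a separable
extension. Moreover, if `vK` is cofinal in `vF` then it can also be assumed that `vK₀` is cofinal
in `vF₀`." VENDORED: the output of this construction for a transcendence basis `𝒯 = {t}` of one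
element and an arbitrary valued base field `(K, V ∩ K)` inside `(Ω, V)` — a subfield `K₀ ≤ K`
containing a prescribed finite `S ⊆ K`, relatively algebraically closed in `K`, of finite rank,
with `Kv|K₀v` algebraic, and `F₀ = K₀(t)(a₁,…,aₙ)`, `K₀ ≤ F₀ ≤ F`, finitely generated and
algebraic over `K₀(t)`, with `F₀.K = F`, `F₀|K₀` separable if `F|K` is, `vK₀` cofinal in `vF₀` if
`vK` is cofinal in `vF`. NOT vendored: (14), and the two conclusions "`K₀` (separably) tame,
`K₀v = Kv`, `vK/vK₀` torsion free" that rest on the tameness of `K` (Lemmas 3.7, 3.15); for a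
separably closed `K` they follow (module docstring). On the conjunction with the cofinality
clause (review of this fact): the cofinality step of the proof of Cor. 3.16 "adds an element `z`
[of `K`, with value outside the convex hull of `vF₀`] to `K₀` and `F₀`", which as stated destroys
"relatively algebraically closed"; the conjunction asserted here holds after re-taking the
relative algebraic closure `K₀'` of `K₀(z)` in `K` — finite rank (`z` is value-transcendental
over `K₀`), `Kv|K₀'v` algebraic and `S ⊆ K₀'` are preserved, `vF₀(z) = vF₀ ⊕ ℤvz` is bounded by
the multiples of `vz ∈ vK₀'`, and `F₀' = K₀'(t)(aᵢ)` is algebraic over `F₀(z)`, so `vK₀'` stays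
cofinal in `vF₀'`. Users take `(h : Kuhlmann2016_Cor38)`.
[cite: Kuhlmann2016, Cor. 3.8 and Cor. 3.16 (with their proofs)] -/
def Kuhlmann2016_Cor38 : Prop :=
  ∀ (Ω : Type u) [Field Ω] (V : ValuationSubring Ω) (K F : Subfield Ω) (t : Ω) (S : Finset Ω),
    K ≤ F → FGOver K F → t ∈ F → Transcendental K t →
    (∀ z ∈ F, IsAlgebraic (IntermediateField.adjoin K ({t} : Set Ω)) z) → (↑S : Set Ω) ⊆ K →
    ∃ K₀ F₀ : Subfield Ω, K₀ ≤ K ∧ (↑S : Set Ω) ⊆ K₀ ∧ (∀ a ∈ K, IsAlgebraic K₀ a → a ∈ K₀) ∧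
      HasFiniteRank V K₀ ∧ IsResiduallyAlgebraicOver V K₀ K ∧
      K₀ ≤ F₀ ∧ F₀ ≤ F ∧ t ∈ F₀ ∧ FGOver K₀ F₀ ∧
      (∀ z ∈ F₀, IsAlgebraic (IntermediateField.adjoin K₀ ({t} : Set Ω)) z) ∧ F₀ ⊔ K = F ∧
      (SeparablyGeneratedOver K F → SeparablyGeneratedOver K₀ F₀) ∧
      (IsValueCofinal V K F → IsValueCofinal V K₀ F₀)

/-- NAMED FACT — **Kuhlmann 2019, Prop. 5.6 (henselian rationality over base fields of finite
rank), for a separably closed base field.** "Every immediate separable function field `(F|K,v)`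
of transcendence degree 1 over a separably tame field `(K,v)` of finite rank is henselian
rational." — with (p. 1) "henselian rational if it admits a transcendence basis `𝒯 ⊂ F` such
that `F` lies in the henselization of the rational function field `K(𝒯)`". Vendored, exactly as
the head fact `Kuhlmann2019_Thm13_sepClosed` (= Prop. 5.7, arbitrary rank), for `K` separably
closed (a separably tame field: henselian with `K^{sep} = K = K^r`), with the extra hypothesis
that `(K, V ∩ K)` has finite rank (`HasFiniteRank`): for `(F|K, V)` immediate, `F|K` finitely
generated, separably generated, of transcendence degree `1`, there is `x ∈ F` transcendental over
`K` with `F ≤ K(x)^h = henselization V K(x)`. Its printed proof (composite places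
`P = P₁P₂P₃`, Lemma 5.5, Prop. 5.2/5.3 in rank one, Lemma 5.4, [16, Thm. 1], [4, (18.2)],
[17, Lemma 3.14, Prop. 2.12], Lemma 2.1) is the next layer of the decomposition. Users take
`(h : Kuhlmann2019_Prop56_sepClosed)`. [cite: Kuhlmann2019, Prop. 5.6] -/
def Kuhlmann2019_Prop56_sepClosed : Prop :=
  ∀ (Ω : Type u) [Field Ω] [IsAlgClosed Ω] (V : ValuationSubring Ω) (K F : Subfield Ω),
    IsSepClosed K → HasFiniteRank V K → K ≤ F → FGOver K F → SeparablyGeneratedOver K F →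
    (∃ x ∈ F, Transcendental K x ∧
      ∀ z ∈ F, IsAlgebraic (IntermediateField.adjoin K ({x} : Set Ω)) z) →
    IsImmediateOver V K F →
    ∃ x ∈ F, Transcendental K x ∧ F ≤ henselization V (Subfield.closure ((K : Set Ω) ∪ {x}))

/-- NAMED FACT — **Kuhlmann 2019, Lemma 5.4 (separating elements with prescribed value and
residue).** "Let `F|K` be a separable function field of transcendence degree 1 and `Q` a
nontrivial place on `F`. Then for every `x ∈ F^×` there exists a separating element `y` of `F|K`
which satisfies `v_Q(y) = v_Q(x)` and if `v_Q(x) = 0`, also `yQ = xQ`." (Proof: one of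
`x, x + az, x + a` for a separating `z` and `a` of large value, by [24, VIII, §4, Prop. 4.8].)
Rendering: `K ≤ F ≤ Ω` with `F|K` finitely generated, separably generated, of transcendence
degree `1`; `Q = V ∩ F` for a valuation ring `V` of `Ω`, non-trivial on `F`; conclusion for
`x ∈ F`, `x ≠ 0`: some `y ∈ F` with every element of `F` separable over `K(y)`,
`v(y) = v(x)`, and `v(y - x) < 1 = v(x)` when `v(x) = 1` (same residue). Users take
`(h : Kuhlmann2019_Lemma54)`. [cite: Kuhlmann2019, Lemma 5.4] -/
def Kuhlmann2019_Lemma54 : Prop :=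
  ∀ (Ω : Type u) [Field Ω] (V : ValuationSubring Ω) (K F : Subfield Ω),
    K ≤ F → FGOver K F → SeparablyGeneratedOver K F →
    (∃ t ∈ F, Transcendental K t ∧
      ∀ z ∈ F, IsAlgebraic (IntermediateField.adjoin K ({t} : Set Ω)) z) →
    (∃ a ∈ F, a ≠ 0 ∧ V.valuation a ≠ 1) →
    ∀ x ∈ F, x ≠ 0 →
      ∃ y ∈ F, (∀ z ∈ F, IsSeparable (IntermediateField.adjoin K ({y} : Set Ω)) z) ∧
        V.valuation y = V.valuation x ∧ (V.valuation x = 1 → V.valuation (y - x) < 1)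

/-- NAMED FACT — **Kuhlmann 2010, Thm. 1.1 (generalized stability theorem), the "separably
defectless" clause, for a rational function field with a value-transcendental generator over a
separably closed field.** Thm. 1.1: "Let `(F|K,v)` be a valued function field without
transcendence defect. If `(K,v)` is a defectless field, then `(F,v)` is a defectless field. The
same holds for 'inseparably defectless' in the place of 'defectless'. If `vK` is cofinal in `vF`,
then it also holds for 'separably defectless' in the place of 'defectless'." (Quoted in Kuhlmann
2019, proof of Prop. 5.7: "According to [16, Theorem 1], `(K₀(x),v)` is a separably defectless
field".) Vendored for `F = K(x)` with `x` value-transcendental over `K`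
(`IsValueTranscendentalOver`: `n·vx ∉ vK` for `n ≥ 1`, so that `trdeg = 1 = rr vK(x)/vK`: no
transcendence defect) and `K ≤ Ω` a separably closed field — a separably defectless field for
every valuation, having no proper finite separable extension — with `vK` cofinal in `vK(x)`:
then `(K(x), V ∩ K(x))` is a separably defectless field. Its printed proof (§5, p. 20: passage
to the completion, [K6], and the "defectless" version of Thm. 1.1) is not available in Mathlib.
Users take `(h : Kuhlmann2010SeparablyDefectlessRational_sepClosed)`.
[cite: Kuhlmann2010, Thm. 1.1] -/
def Kuhlmann2010SeparablyDefectlessRational_sepClosed : Prop :=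
  ∀ (Ω : Type u) [Field Ω] (V : ValuationSubring Ω) (K : Subfield Ω) (x : Ω),
    IsSepClosed K → IsValueTranscendentalOver V K x →
    IsValueCofinal V K (Subfield.closure ((K : Set Ω) ∪ {x})) →
    IsSeparablyDefectlessField (Subfield.closure ((K : Set Ω) ∪ {x}))
      (V.comap (algebraMap (Subfield.closure ((K : Set Ω) ∪ {x})) Ω))

/-- NAMED FACT — **Kuhlmann 2010, Thm. 2.14, the "separably defectless" clause** (= Endler,
*Valuation theory*, Thm. (18.2), as quoted in Kuhlmann 2019, proof of Prop. 5.7: "the same is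
true for `(K₀(x)^h,v)` by [4, Theorem (18.2)]"): "Take a valued field `(K,v)` and fix an
extension of `v` to `K̃`. Then `(K,v)` is defectless if and only if its henselization `(K,v)^h`
in `(K̃,v)` is defectless. The same holds for 'separably defectless' and 'inseparably
defectless' in the place of 'defectless'. *Proof.* For 'separably defectless', our assertion
follows directly from [En], Theorem (18.2)." Rendering as for `Kuhlmann2010DefectlessIffHenselization`
(`Henselization.lean`, the "defectless" clause, discharged in `HenselizationDefectless.lean`):
for `Ω` algebraically closed, `(E, V ∩ E)` is separably defectless iff `(E^h, V ∩ E^h)` is,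
`E^h = henselization V E`. Users take `(h : Kuhlmann2010SeparablyDefectlessIffHenselization)`.
[cite: Kuhlmann2010, Thm. 2.14] -/
def Kuhlmann2010SeparablyDefectlessIffHenselization : Prop :=
  ∀ (Ω : Type u) [Field Ω] [IsAlgClosed Ω] (V : ValuationSubring Ω) (E : Subfield Ω),
    IsSeparablyDefectlessField E (V.comap (algebraMap E Ω)) ↔
      IsSeparablyDefectlessField (henselization V E)
        (V.comap (algebraMap (henselization V E) Ω))

/-! ### API -/

/-- The finite-rank case of the head fact is literally `Kuhlmann2019_Prop56_sepClosed`: under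
`HasFiniteRank V K`, Thm. 1.3 (separably closed `K`) holds by Prop. 5.6. [cite: Kuhlmann2019, Prop. 5.6] -/
theorem Kuhlmann2019_Prop56_sepClosed.thm13_of_hasFiniteRank (h : Kuhlmann2019_Prop56_sepClosed.{u})
    (Ω : Type u) [Field Ω] [IsAlgClosed Ω] (V : ValuationSubring Ω) (K F : Subfield Ω)
    (hK : IsSepClosed K) (hr : HasFiniteRank V K) (hKF : K ≤ F) (hfg : FGOver K F)
    (hsep : SeparablyGeneratedOver K F)
    (h1 : ∃ x ∈ F, Transcendental K x ∧
      ∀ z ∈ F, IsAlgebraic (IntermediateField.adjoin K ({x} : Set Ω)) z)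
    (himm : IsImmediateOver V K F) :
    ∃ x ∈ F, Transcendental K x ∧ F ≤ henselization V (Subfield.closure ((K : Set Ω) ∪ {x})) :=
  h Ω V K F hK hr hKF hfg hsep h1 himm

/-- Over a henselian, separably defectless `(E, V ∩ E)` the henselization changes nothing, so
Thm. 2.14 (separable clause) is consistent with `henselization_eq_self_of_isHenselianField`:
for such `E`, `E^h = E` is separably defectless. [folklore] -/
theorem Kuhlmann2010SeparablyDefectlessIffHenselization.of_isHenselianField
    {Ω : Type u} [Field Ω] [IsAlgClosed Ω] (V : ValuationSubring Ω) (E : Subfield Ω)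
    (hE : IsHenselianField E (V.comap (algebraMap E Ω)))
    (hsd : IsSeparablyDefectlessField E (V.comap (algebraMap E Ω))) :
    IsSeparablyDefectlessField (henselization V E)
      (V.comap (algebraMap (henselization V E) Ω)) := by
  rw [henselization_eq_self_of_isHenselianField V E hE]
  exact hsd

end Literature.AlgebraicGeometry.Resolution
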